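import Mathlib
import HarnessLib
import Summits.Ventures.LatticeQCDFlow.Scoring.DoeblinPowerBatchMeansCLT
import Summits.Ventures.LatticeQCDFlow.Scoring.LogRatioAgreementCLT

/-!
# THE DELTA METHOD WITH THE BATCH-MEANS ERROR BAR under a Doeblin power, from any initial law:
# `√N (φ(f̄_N) − φ(πf)) / (|φ'(f̄_N)| σ̂_N) ⇒ N(0, 1)` and its exact coverage; the `log` of an average

HONEST FRAMING: exact (Metropolis-corrected) sampling algorithms for lattice gauge theory;
figures of merit are autocorrelation/cost numbers at stated couplings and volumes; no
continuum-physics claim.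

Venture `LatticeQCDFlow` (cell pub-lqcd), topic `Scoring`; FANOUT row 8 (`s0-cpn-nemc`, GEN-22).
NEW WORK of the cell, not a published result; no definition is introduced; nothing is cited as a
fact.  A printed column is often a smooth FUNCTION of one chain average — a free-energy
difference `−log ⟨e^{−W}⟩` along the chain of (correlated) work values of a non-equilibrium run,
`−log` of an acceptance, a `logit` of an occupancy fraction.  GEN-20's
`Scoring/DoeblinPowerBatchMeansCLT.lean` studentises the average itself; this file composes it
with the delta method (`Scoring/DeltaMethod.tendstoInDistribution_deltaMethod`): for every kernel
with a Doeblin power `(nHit κ m)(z,·) ≥ ε ν`, `π` invariant, `|f| ≤ C` measurable with `σ²_f > 0`,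
`φ` measurable with derivative `d ≠ 0` at `u = πf`, a measurable plug-in `D` for the derivative
(continuous at `u`, `D u = d`; e.g. `D = φ'`), any `a_n, b_n → ∞` (`N_n = b_n a_n`) and EVERY initial
law: `√N_n (φ(f̄_{N_n}) − φ(u)) / (|D(f̄_{N_n})| σ̂_n) ⇒ N(0, 1)` (`σ̂²_n` the batch-means estimator
of the same run), with asymptotically exact coverage of `φ(f̄) ± z |D(f̄)| σ̂/√N`.  Route:
`√N (f̄ − u) ⇒ N(0, σ²_f)` (row 13's CLT along `N_n`), delta method, `f̄ → u`, `D(f̄) → d` and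
`σ̂² → σ²_f` in probability, Slutsky with the denominator truncated below at half its limit, the
truncation is eventually invisible, and the limit `(d/|d|) Y` has the law of `Y`.  Instance: the
`log` of a positive average (`φ = log`, `D = 1/x`), i.e. free energies `−log ⟨e^{−W}⟩`.  Two small
tools of independent use are proved here: convergence in distribution sees the limit only through
its LAW, and continuous mapping in probability for PAIRS.  Printed counterparts NAMED ONLY: the
delta method for MCMC estimators with batch-means error bars (Flegal–Jones 2010 §3), nothing
cited as a fact.

## Content (`N_n = b_n a_n`; `u = πf`; `σ̂²_n = a_n b_n · SE²_BM`)

* `tendstoInDistribution_of_map_eq` — law transfer for the limit of `⇒`;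
* `tendstoInMeasure_pair_comp` — `Uₙ → u`, `Wₙ → w` in probability, `ψ` continuous at `(u, w)` ⇒
  `ψ(Uₙ, Wₙ) → ψ(u, w)` in probability;
* **`doeblinPower_batchMeans_deltaMethod_clt`** — for `Y ~ N(0,1)`:
  `TendstoInDistribution (fun n x => √N_n (φ(f̄) − φ(u)) / (|D(f̄)| √(σ̂²_n))) atTop Y P_{μ₀}`;
* **`doeblinPower_batchMeans_deltaMethod_coverage`** — `z > 0`:
  `P_{μ₀} {|√N_n (φ(f̄) − φ(u))| / (|D(f̄)| √(σ̂²_n)) ≤ z} → (gaussianReal 0 1)[−z, z]`;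
* **`doeblinPower_batchMeans_log_clt`** — `u > 0`: `√N_n (log f̄ − log u) / (|f̄⁻¹| √(σ̂²_n)) ⇒ Y`.

NOT CLAIMED: a rate; `d = 0` (second-order delta method); `σ²_f = 0`; unbounded `f`; any number.
-/

noncomputable section

namespace Summit.Ventures.LatticeQCDFlow.Scoring

open MeasureTheory ProbabilityTheory Filter Finset Preorder
open scoped ENNReal Topology

/-! ### Two tools -/

section Tools

/-- **Law transfer**: if `Xₙ ⇒ Z` and `Z'` (on another probability space) has the same law as
`Z`, then `Xₙ ⇒ Z'`. -/
theorem tendstoInDistribution_of_map_eq {α : Type*} [MeasurableSpace α] {μ : Measure α}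
    [IsProbabilityMeasure μ] {Ω' Ω'' : Type*} [MeasurableSpace Ω'] [MeasurableSpace Ω'']
    {P' : Measure Ω'} [IsProbabilityMeasure P'] {P'' : Measure Ω''} [IsProbabilityMeasure P'']
    {X : ℕ → α → ℝ} {Z : Ω' → ℝ} {Z' : Ω'' → ℝ}
    (h : TendstoInDistribution X atTop Z (fun _ => μ) P') (hZ' : AEMeasurable Z' P'')
    (hlaw : P''.map Z' = P'.map Z) :
    TendstoInDistribution X atTop Z' (fun _ => μ) P'' := by
  refine ⟨h.forall_aemeasurable, hZ', ?_⟩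
  have e : (⟨P''.map Z', Measure.isProbabilityMeasure_map hZ'⟩ : ProbabilityMeasure ℝ)
      = ⟨P'.map Z, Measure.isProbabilityMeasure_map h.aemeasurable_limit⟩ := Subtype.ext hlaw
  rw [e]
  exact h.tendsto

/-- **Continuous mapping in probability, two arguments**: `Uₙ → u`, `Wₙ → w` in probability and
`ψ : ℝ × ℝ → ℝ` continuous at `(u, w)` ⇒ `ψ(Uₙ, Wₙ) → ψ(u, w)` in probability. -/
theorem tendstoInMeasure_pair_comp {α : Type*} [MeasurableSpace α] {P : Measure α}
    {U W : ℕ → α → ℝ} {u w : ℝ}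
    (hU : TendstoInMeasure P U atTop fun _ => u) (hW : TendstoInMeasure P W atTop fun _ => w)
    {ψ : ℝ × ℝ → ℝ} (hψ : ContinuousAt ψ (u, w)) :
    TendstoInMeasure P (fun n ω => ψ (U n ω, W n ω)) atTop fun _ => ψ (u, w) :=
  CardConsistency.tendstoInMeasure_comp_continuousAt_normed
    (CardConsistency.tendstoInMeasure_prodMk hU hW) hψ

/-- `√n · ((Σ_{t<n} a_t)/n − u) = (√n)⁻¹ · Σ_{t<n} (a_t − u)` for every `n`. -/
private theorem sqrt_mul_avg_sub (c : ℕ → ℝ) (u : ℝ) (n : ℕ) :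
    Real.sqrt n * ((∑ t ∈ Finset.range n, c t) / n - u)
      = (Real.sqrt n)⁻¹ * ∑ t ∈ Finset.range n, (c t - u) := by
  rcases Nat.eq_zero_or_pos n with hn | hn
  · subst hn; simp
  · have hnR : (0 : ℝ) < n := Nat.cast_pos.2 hn
    have hs : (0 : ℝ) < Real.sqrt n := Real.sqrt_pos.2 hnR
    have hinv : (Real.sqrt n)⁻¹ = Real.sqrt n / n := by
      rw [eq_div_iff hnR.ne']
      calc (Real.sqrt n)⁻¹ * (n : ℝ) = (Real.sqrt n)⁻¹ * (Real.sqrt n * Real.sqrt n) := by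
            rw [Real.mul_self_sqrt hnR.le]
        _ = Real.sqrt n := by rw [← mul_assoc, inv_mul_cancel₀ hs.ne', one_mul]
    rw [Finset.sum_sub_distrib, Finset.sum_const, Finset.card_range, nsmul_eq_mul, hinv]
    field_simp

end Tools

variable {Ω : Type*} [MeasurableSpace Ω]
  {κ : Kernel Ω Ω} [IsMarkovKernel κ] {ν : Measure Ω} [IsProbabilityMeasure ν] {ε : ℝ≥0∞} {m : ℕ}

/-! ### The studentised delta method -/

section DeltaMethod

/-- **THE DELTA METHOD WITH THE BATCH-MEANS ERROR BAR, FROM ANY INITIAL LAW.**  `π` invariant,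
`(nHit κ m)(z,·) ≥ ε ν` (`0 < ε ≤ 1`, `0 < m`), `|f| ≤ C` measurable, `σ²_f > 0`; `φ` measurable
with `HasDerivAt φ d (πf)`, `d ≠ 0`; `D` measurable, continuous at `πf`, `D(πf) = d`; `a_n, b_n → ∞`,
`N_n = b_n a_n`, `f̄ = Σ_{t<N_n} f(x_t)/N_n`; for `Y ~ N(0, 1)`:
`√N_n (φ(f̄) − φ(πf)) / (|D(f̄)| √(σ̂²_n)) ⇒ Y` under `P_{μ₀}`. -/
theorem doeblinPower_batchMeans_deltaMethod_clt {π : Measure Ω} [IsProbabilityMeasure π]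
    (hπ : Kernel.Invariant κ π) (hmin : ∀ z, ε • ν ≤ Exactness.nHit κ m z) (hε0 : 0 < ε)
    (hε1 : ε ≤ 1) (hm : 0 < m)
    {f : Ω → ℝ} (hf : Measurable f) {C : ℝ} (hC : ∀ x, |f x| ≤ C)
    (hσ : 0 < ((∫ y, (f y - ∫ z, f z ∂π) ^ 2 ∂π)
            + 2 * ∑' k, ∫ y, (f y - ∫ z, f z ∂π) * (kop κ)^[k + 1] (fun y => f y - ∫ z, f z ∂π) y ∂π))
    {φ D : ℝ → ℝ} {d : ℝ} (hφ : HasDerivAt φ d (∫ z, f z ∂π)) (hφm : Measurable φ) (hd : d ≠ 0)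
    (hDm : Measurable D) (hDc : ContinuousAt D (∫ z, f z ∂π)) (hDu : D (∫ z, f z ∂π) = d)
    (μ₀ : Measure Ω) [IsProbabilityMeasure μ₀] {a b : ℕ → ℕ} (ha : Tendsto a atTop atTop)
    (hb : Tendsto b atTop atTop)
    {Ω' : Type*} [MeasurableSpace Ω'] {P' : Measure Ω'} [IsProbabilityMeasure P'] {Y : Ω' → ℝ}
    (hY : HasLaw Y (gaussianReal 0 1) P')
    [IsProbabilityMeasure (Kernel.trajMeasure (X := fun _ : ℕ => Ω) μ₀
          (fun n : ℕ => κ.comap (fun h : (i : ↥(Finset.Iic n)) → Ω => h ⟨n, Finset.mem_Iic.2 le_rfl⟩)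
            (measurable_pi_apply _)))] :
    TendstoInDistribution (fun (n : ℕ) (x : ℕ → Ω) =>
        Real.sqrt ((b n * a n : ℕ) : ℝ) * (φ ((∑ t ∈ Finset.range (b n * a n), f (x t)) / ((b n * a n : ℕ) : ℝ)) - φ (∫ z, f z ∂π))
          / (|D ((∑ t ∈ Finset.range (b n * a n), f (x t)) / ((b n * a n : ℕ) : ℝ))|
            * Real.sqrt (((b n * a n : ℕ) : ℝ) * replicaSEsq (fun j (x : ℕ → Ω) =>
              (∑ i ∈ Finset.range (b n), f (x (b n * j + i))) / (b n)) (a n) x)))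
      atTop Y (fun _ => (Kernel.trajMeasure (X := fun _ : ℕ => Ω) μ₀
          (fun n : ℕ => κ.comap (fun h : (i : ↥(Finset.Iic n)) → Ω => h ⟨n, Finset.mem_Iic.2 le_rfl⟩)
            (measurable_pi_apply _)))) P' := by
  set P := (Kernel.trajMeasure (X := fun _ : ℕ => Ω) μ₀
          (fun n : ℕ => κ.comap (fun h : (i : ↥(Finset.Iic n)) → Ω => h ⟨n, Finset.mem_Iic.2 le_rfl⟩)
            (measurable_pi_apply _))) with hP
  obtain ⟨σ2, hσ2⟩ : ∃ s : ℝ, s = ((∫ y, (f y - ∫ z, f z ∂π) ^ 2 ∂π)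
            + 2 * ∑' k, ∫ y, (f y - ∫ z, f z ∂π) * (kop κ)^[k + 1] (fun y => f y - ∫ z, f z ∂π) y ∂π) := ⟨_, rfl⟩
  rw [← hσ2] at hσ
  have hsv : Real.sqrt σ2 ≠ 0 := (Real.sqrt_pos.2 hσ).ne'
  set u := ∫ z, f z ∂π with hu
  set N : ℕ → ℕ := fun n => b n * a n with hN
  have hN_tend : Tendsto N atTop atTop := hb.atTop_mul_atTop₀ ha
  have haN : Tendsto (fun n : ℕ => Real.sqrt ((N n : ℕ) : ℝ)) atTop atTop :=
    Real.tendsto_sqrt_atTop.comp ((tendsto_natCast_atTop_atTop (R := ℝ)).comp hN_tend)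
  -- the average and the batch-means statistic, as opaque functions
  obtain ⟨M, hM⟩ : ∃ M : ℕ → (ℕ → Ω) → ℝ, M = fun (n : ℕ) (x : ℕ → Ω) =>
      (∑ t ∈ Finset.range (N n), f (x t)) / ((N n : ℕ) : ℝ) := ⟨_, rfl⟩
  obtain ⟨S, hS⟩ : ∃ S : ℕ → (ℕ → Ω) → ℝ, S = fun (n : ℕ) (x : ℕ → Ω) =>
      ((b n * a n : ℕ) : ℝ) * replicaSEsq (fun j (x : ℕ → Ω) =>
              (∑ i ∈ Finset.range (b n), f (x (b n * j + i))) / (b n)) (a n) x := ⟨_, rfl⟩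
  have hMm : ∀ n, Measurable (M n) := fun n => by
    rw [hM]
    exact (Finset.measurable_sum _ fun t _ => hf.comp (measurable_pi_apply t)).div_const _
  have hSm : ∀ n, Measurable (S n) := fun n => by
    rw [hS]; exact measurable_batchMeans_sigmaHat hf (a n) (b n)
  -- (1) the CLT for the average along `N n`, limit `√σ² · Y ~ N(0, σ²)`
  have hY₁ : HasLaw (fun ω => Real.sqrt σ2 * Y ω) (gaussianReal 0 σ2.toNNReal) P' := by
    refine ⟨hY.aemeasurable.const_mul _, ?_⟩
    rw [show (fun ω => Real.sqrt σ2 * Y ω) = (fun a : ℝ => Real.sqrt σ2 * a) ∘ Y from rfl,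
      ← AEMeasurable.map_map_of_aemeasurable (measurable_const_mul _).aemeasurable hY.aemeasurable,
      hY.map_eq, gaussianReal_map_const_mul, mul_zero, mul_one]
    congr 1
    apply NNReal.coe_injective
    rw [NNReal.coe_mk, Real.coe_toNNReal _ hσ.le, Real.sq_sqrt hσ.le]
  have hY₁' : HasLaw (fun ω => Real.sqrt σ2 * Y ω) (gaussianReal 0 (Real.toNNReal
      ((∫ y, (f y - ∫ z, f z ∂π) ^ 2 ∂π)
            + 2 * ∑' k, ∫ y, (f y - ∫ z, f z ∂π) * (kop κ)^[k + 1] (fun y => f y - ∫ z, f z ∂π) y ∂π))) P' := by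
    rw [← hσ2]; exact hY₁
  have hclt := Exactness.GeneralNCMC.tendstoInDistribution_timeAverage_of_nHit hπ hε0.ne' hmin hm
    hf hC μ₀ hY₁'
  have hA : TendstoInDistribution (fun n x => Real.sqrt ((N n : ℕ) : ℝ) * (M n x - u)) atTop
      (fun ω => Real.sqrt σ2 * Y ω) (fun _ => P) P' := by
    have h0 : TendstoInDistribution (fun (n : ℕ) (x : ℕ → Ω) =>
        (Real.sqrt ((N n : ℕ) : ℝ))⁻¹ * ∑ t ∈ Finset.range (N n), (f (x t) - u)) atTop
        (fun ω => Real.sqrt σ2 * Y ω) (fun _ => P) P' :=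
      ⟨fun n => hclt.forall_aemeasurable (N n), hclt.aemeasurable_limit, hclt.tendsto.comp hN_tend⟩
    rw [hM]
    exact h0.congr (fun n => Eventually.of_forall fun x =>
      (sqrt_mul_avg_sub (fun t => f (x t)) u (N n)).symm) EventuallyEq.rfl
  -- (2) the delta method
  have hB := CardConsistency.tendstoInDistribution_deltaMethod haN hA (fun n => (hMm n).aemeasurable)
    hφ hφm
  -- (3) the plug-ins converge in probability
  have hMu : TendstoInMeasure P M atTop (fun _ => u) :=
    CardConsistency.tendstoInMeasure_of_tendstoInDistribution_scaled haN hA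
  have hDlim : TendstoInMeasure P (fun n x => |D (M n x)|) atTop (fun _ => |d|) := by
    have h := CardConsistency.tendstoInMeasure_comp_continuousAt hMu (φ := fun y => |D y|)
      (continuous_abs.continuousAt.comp hDc)
    rw [hDu] at h
    exact h
  have hSlim : TendstoInMeasure P S atTop (fun _ => σ2) := by
    rw [hS, hσ2, hP]
    exact chain_batchMeans_sigmaHat_tendstoInMeasure_of_nHit hπ
      (Exactness.GeneralNCMC.minorised_setwise hmin) hε0 hε1 hm hf hC μ₀ ha hb
  have hms : ∀ p : ℝ × ℝ, ContinuousAt (fun q : ℝ × ℝ => q.1 * Real.sqrt q.2) p := fun p =>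
    (continuous_fst.mul (Real.continuous_sqrt.comp continuous_snd)).continuousAt
  have hW := tendstoInMeasure_pair_comp hDlim hSlim (hms _)
  obtain ⟨w₀, hw₀⟩ : ∃ w : ℝ, w = |d| * Real.sqrt σ2 := ⟨_, rfl⟩
  have hw₀pos : 0 < w₀ := by rw [hw₀]; exact mul_pos (abs_pos.2 hd) (Real.sqrt_pos.2 hσ)
  have hW' : TendstoInMeasure P (fun n x => |D (M n x)| * Real.sqrt (S n x)) atTop (fun _ => w₀) := by
    rw [hw₀]; exact hW
  -- (4) Slutsky with the continuous map `(p, w) ↦ p / max(w, w₀/2)`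
  have hgc : Continuous fun q : ℝ × ℝ => q.1 / max q.2 (w₀ / 2) :=
    continuous_fst.div (continuous_snd.max continuous_const) fun q =>
      (lt_max_of_lt_right (by positivity)).ne'
  have hWm : ∀ n, Measurable fun x => |D (M n x)| * Real.sqrt (S n x) := fun n =>
    (continuous_abs.measurable.comp (hDm.comp (hMm n))).mul
      (Real.continuous_sqrt.measurable.comp (hSm n))
  have hSl := hB.continuous_comp_prodMk_of_tendstoInMeasure_const hgc hW'
    (fun n => (hWm n).aemeasurable)
  have hSl' := hSl.congr (fun n => EventuallyEq.rfl) (ae_of_all _ fun ω => (by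
    show d * (Real.sqrt σ2 * Y ω) / max w₀ (w₀ / 2) = d / |d| * Y ω
    rw [max_eq_left (by linarith), hw₀]
    field_simp))
  -- (5) the studentised statistic differs from the Slutsky statistic only where the denominator
  -- is below `w₀/2`
  have hTm : ∀ n, AEMeasurable (fun x => Real.sqrt ((N n : ℕ) : ℝ) * (φ (M n x) - φ u)
      / (|D (M n x)| * Real.sqrt (S n x))) P := fun n =>
    ((measurable_const.mul ((hφm.comp (hMm n)).sub measurable_const)).div (hWm n)).aemeasurable
  have hT : TendstoInDistribution (fun n x => Real.sqrt ((N n : ℕ) : ℝ) * (φ (M n x) - φ u)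
      / (|D (M n x)| * Real.sqrt (S n x))) atTop (fun ω => d / |d| * Y ω) (fun _ => P) P' := by
    refine tendstoInDistribution_of_tendstoInMeasure_sub _ _ hSl' ?_ hTm
    rw [tendstoInMeasure_iff_measureReal_norm]
    intro δ hδ
    have hW'' := (tendstoInMeasure_iff_measureReal_norm.1 hW') (w₀ / 2) (by positivity)
    refine squeeze_zero' (Eventually.of_forall fun n => measureReal_nonneg)
      (Eventually.of_forall fun n => ?_) hW''
    refine measureReal_mono fun x hx => ?_
    simp only [Set.mem_setOf_eq, Pi.sub_apply, Pi.zero_apply, sub_zero] at hx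
    rw [Set.mem_setOf_eq]
    by_contra hcon
    rw [not_le, Real.norm_eq_abs, abs_lt] at hcon
    have hmax : max (|D (M n x)| * Real.sqrt (S n x)) (w₀ / 2) = |D (M n x)| * Real.sqrt (S n x) :=
      max_eq_left (by linarith [hcon.1])
    rw [hmax, sub_self, norm_zero] at hx
    exact absurd hx (not_le.2 hδ)
  -- (6) `(d/|d|) Y ~ N(0, 1)`: transfer the limit to `Y`
  have hlaw : P'.map Y = P'.map (fun ω => d / |d| * Y ω) := by
    rw [hY.map_eq, (gaussianReal_const_mul hY (d / |d|)).map_eq, mul_zero]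
    congr 1
    apply NNReal.coe_injective
    rw [NNReal.coe_mul, NNReal.coe_mk, NNReal.coe_one, mul_one, div_pow, sq_abs,
      div_self (pow_ne_zero 2 hd)]
  have hfinal := tendstoInDistribution_of_map_eq hT hY.aemeasurable hlaw
  rw [hM, hS] at hfinal
  exact hfinal

/-- **ASYMPTOTICALLY EXACT COVERAGE OF THE DELTA-METHOD INTERVAL.**  Under the hypotheses of
`doeblinPower_batchMeans_deltaMethod_clt`, for every `z > 0`:
`P_{μ₀}(|√N_n (φ(f̄) − φ(πf))| / (|D(f̄)| √(σ̂²_n)) ≤ z) → (gaussianReal 0 1)[−z, z]`. -/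
theorem doeblinPower_batchMeans_deltaMethod_coverage {π : Measure Ω} [IsProbabilityMeasure π]
    (hπ : Kernel.Invariant κ π) (hmin : ∀ z, ε • ν ≤ Exactness.nHit κ m z) (hε0 : 0 < ε)
    (hε1 : ε ≤ 1) (hm : 0 < m)
    {f : Ω → ℝ} (hf : Measurable f) {C : ℝ} (hC : ∀ x, |f x| ≤ C)
    (hσ : 0 < ((∫ y, (f y - ∫ z, f z ∂π) ^ 2 ∂π)
            + 2 * ∑' k, ∫ y, (f y - ∫ z, f z ∂π) * (kop κ)^[k + 1] (fun y => f y - ∫ z, f z ∂π) y ∂π))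
    {φ D : ℝ → ℝ} {d : ℝ} (hφ : HasDerivAt φ d (∫ z, f z ∂π)) (hφm : Measurable φ) (hd : d ≠ 0)
    (hDm : Measurable D) (hDc : ContinuousAt D (∫ z, f z ∂π)) (hDu : D (∫ z, f z ∂π) = d)
    (μ₀ : Measure Ω) [IsProbabilityMeasure μ₀] {a b : ℕ → ℕ} (ha : Tendsto a atTop atTop)
    (hb : Tendsto b atTop atTop) {z : ℝ} (hz : 0 < z) :
    Tendsto (fun n : ℕ => (Kernel.trajMeasure (X := fun _ : ℕ => Ω) μ₀
          (fun n : ℕ => κ.comap (fun h : (i : ↥(Finset.Iic n)) → Ω => h ⟨n, Finset.mem_Iic.2 le_rfl⟩)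
            (measurable_pi_apply _))).real
      {x | |Real.sqrt ((b n * a n : ℕ) : ℝ) * (φ ((∑ t ∈ Finset.range (b n * a n), f (x t)) / ((b n * a n : ℕ) : ℝ)) - φ (∫ z, f z ∂π))
          / (|D ((∑ t ∈ Finset.range (b n * a n), f (x t)) / ((b n * a n : ℕ) : ℝ))|
            * Real.sqrt (((b n * a n : ℕ) : ℝ) * replicaSEsq (fun j (x : ℕ → Ω) =>
              (∑ i ∈ Finset.range (b n), f (x (b n * j + i))) / (b n)) (a n) x))| ≤ z})
      atTop (𝓝 ((gaussianReal 0 1).real (Set.Icc (-z) z))) := by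
  haveI hPI : IsProbabilityMeasure (Kernel.trajMeasure (X := fun _ : ℕ => Ω) μ₀
          (fun n : ℕ => κ.comap (fun h : (i : ↥(Finset.Iic n)) → Ω => h ⟨n, Finset.mem_Iic.2 le_rfl⟩)
            (measurable_pi_apply _))) := inferInstance
  have hY : HasLaw (fun a : ℝ => a) (gaussianReal 0 1) (gaussianReal 0 1) :=
    ⟨aemeasurable_id', Measure.map_id'⟩
  have hclt := doeblinPower_batchMeans_deltaMethod_clt (κ := κ) (ν := ν) hπ hmin hε0 hε1 hm hf hC hσ
    hφ hφm hd hDm hDc hDu μ₀ ha hb hY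
  have hE : ((gaussianReal 0 1).map (fun a : ℝ => a)) (frontier (Set.Icc (-z) z)) = 0 := by
    rw [Measure.map_id', frontier_Icc (by linarith)]
    haveI := nullSingletonClass_gaussianReal (μ := 0) one_ne_zero
    exact (Set.toFinite _).measure_zero _
  have key := ProbabilityMeasure.tendsto_measure_of_null_frontier_of_tendsto' hclt.tendsto hE
  have key' := (ENNReal.tendsto_toReal (measure_ne_top _ (Set.Icc (-z) z))).comp key
  simp only [ProbabilityMeasure.coe_mk, Function.comp_def, Measure.map_id'] at key'
  simp only [measureReal_def]
  refine (tendsto_congr fun n => ?_).1 key'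
  rw [Measure.map_apply_of_aemeasurable (hclt.forall_aemeasurable n) measurableSet_Icc]
  congr 2
  ext x
  simp only [Set.mem_preimage, Set.mem_Icc, Set.mem_setOf_eq, abs_le]

/-- **THE `log` OF A POSITIVE AVERAGE (free energies `−log ⟨e^{−W}⟩`).**  Same chain hypotheses,
`σ²_f > 0`, `πf > 0`; for `Y ~ N(0, 1)`:
`√N_n (log f̄ − log πf) / (|f̄⁻¹| √(σ̂²_n)) ⇒ Y` under `P_{μ₀}` — the error bar of `log f̄` is
`σ̂_n/(|f̄| √N_n)`. -/
theorem doeblinPower_batchMeans_log_clt {π : Measure Ω} [IsProbabilityMeasure π]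
    (hπ : Kernel.Invariant κ π) (hmin : ∀ z, ε • ν ≤ Exactness.nHit κ m z) (hε0 : 0 < ε)
    (hε1 : ε ≤ 1) (hm : 0 < m)
    {f : Ω → ℝ} (hf : Measurable f) {C : ℝ} (hC : ∀ x, |f x| ≤ C)
    (hσ : 0 < ((∫ y, (f y - ∫ z, f z ∂π) ^ 2 ∂π)
            + 2 * ∑' k, ∫ y, (f y - ∫ z, f z ∂π) * (kop κ)^[k + 1] (fun y => f y - ∫ z, f z ∂π) y ∂π))
    (hu : 0 < ∫ z, f z ∂π)
    (μ₀ : Measure Ω) [IsProbabilityMeasure μ₀] {a b : ℕ → ℕ} (ha : Tendsto a atTop atTop)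
    (hb : Tendsto b atTop atTop)
    {Ω' : Type*} [MeasurableSpace Ω'] {P' : Measure Ω'} [IsProbabilityMeasure P'] {Y : Ω' → ℝ}
    (hY : HasLaw Y (gaussianReal 0 1) P')
    [IsProbabilityMeasure (Kernel.trajMeasure (X := fun _ : ℕ => Ω) μ₀
          (fun n : ℕ => κ.comap (fun h : (i : ↥(Finset.Iic n)) → Ω => h ⟨n, Finset.mem_Iic.2 le_rfl⟩)
            (measurable_pi_apply _)))] :
    TendstoInDistribution (fun (n : ℕ) (x : ℕ → Ω) =>
        Real.sqrt ((b n * a n : ℕ) : ℝ) * (Real.log ((∑ t ∈ Finset.range (b n * a n), f (x t)) / ((b n * a n : ℕ) : ℝ)) - Real.log (∫ z, f z ∂π))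
          / (|((∑ t ∈ Finset.range (b n * a n), f (x t)) / ((b n * a n : ℕ) : ℝ))⁻¹|
            * Real.sqrt (((b n * a n : ℕ) : ℝ) * replicaSEsq (fun j (x : ℕ → Ω) =>
              (∑ i ∈ Finset.range (b n), f (x (b n * j + i))) / (b n)) (a n) x)))
      atTop Y (fun _ => (Kernel.trajMeasure (X := fun _ : ℕ => Ω) μ₀
          (fun n : ℕ => κ.comap (fun h : (i : ↥(Finset.Iic n)) → Ω => h ⟨n, Finset.mem_Iic.2 le_rfl⟩)
            (measurable_pi_apply _)))) P' :=
  doeblinPower_batchMeans_deltaMethod_clt hπ hmin hε0 hε1 hm hf hC hσ (Real.hasDerivAt_log hu.ne')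
    Real.measurable_log (inv_ne_zero hu.ne') measurable_inv (continuousAt_inv₀ hu.ne') rfl μ₀ ha hb
    hY

end DeltaMethod

end Summit.Ventures.LatticeQCDFlow.Scoring

end
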